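import Summits.HodgeConjecture.HodgeConjecture.Theorems.Ring2WeilCoverageWeilGramLevel36SqrtNegThree
import Summits.HodgeConjecture.HodgeConjecture.Theorems.Ring2WeilCoverageSurdTypesLevel36
import HarnessLib

/-!
# Weil-type family coverage — THE COMPONENTS OF THE WEIL-TYPE `ℤ[ζ₃₆]`-SIXFOLDS, VI: the SURD type `(1 + 2√3)`
# (`ϖ₁₁ = 1 + 2θ₃`, `θ₃ = ζ³ + ζ³³ = √3`, `𝔬𝔣₀·(1 − 2θ₃) = (11)`, degree `11³`) against `√−3`: Gram determinant
# `−2299968 = −33·264²` — class `[−11]`, `T = {3, 11}`: the NON-SPLIT component `(3, ℚ(√−3), 11)` (R2 family, `a = 11`)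

research route conditional on HC_CM; not a corollary; Q11.4-sentence-2 already refuted in dim ≥ 3.

Ring 2, WEIL-TYPE FAMILY-COVERAGE CENSUS (`HOME/WEIL-FAMILY-COVERAGE.md` `## b01`, block b01.41 (B′)/(C): «`1331`
(`T = {3,11}`) at `(36, √−3)`: `(3, ℚ(√−3), 11)` (= b01.17 `A₃₆` «{3,p}, p ≡ 11 (12)»)», S-pencil there), part 114 of the
`Ring2WeilCoverage*` series; continues parts 109–111.  Part 54c (`Ring2WeilCoverageSurdTypesLevel36`) proved that EVERY
`ℚ(√−3)`-balanced CM type `Φ` of `ℚ(ζ₃₆)` carries a `Φ`-positive divisor of type `𝔣₀`, `𝔬𝔣₀ = (ϖ₁₁)`.  Here: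

* §1 the eleven traces and **`det a(ϖ₁₁ξ) = −2299968 = −33·264²`** (`= N(ϖ₁₁)·1728 = (−1331)·1728`).
* §2 invariance (THEOREM L (i) at `36`); CENSUS FORM; class **`[−2299968] = [−11]`** (`11/2299968 = 3·(1/792)²`)
  **`≠ splitDiscriminantClass 3 3`** (ring2-b04's census key `sixfold_sqrtNeg3_neg11_ne_split`): **the type-`(1 + 2√3)`
  polarised Weil-type `ℤ[ζ₃₆]`-CM sixfolds lie on the NON-SPLIT component `(3, ℚ(√−3), 11)`**, `T = {3, 11}` —
  pub-hsemireg row R2 (`a = 11`), for every `ℚ(√−3)`-balanced CM type.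

HONEST FRAMING as parts 109–111; `HC_CM` is used nowhere.  No `def`, no named fact, no `sorry`.  Certificates from
`work/py/gen6.py` + `lev36.py`, re-verified by `linear_combination`.

References: [cite: vanGeemen1994HodgeAV, Lemma 5.2 (2)–(4), 5.4 and (5.4.1)]; [cite: Shimura1998, §14.3 Prop. 4–5,
pp. 103–104]; [cite: Serre1973, Ch. III §1]; census b01.17, b01.41 (B′)/(C) (seat-derived).
-/

noncomputable section

open Polynomial NumberField Module
open scoped nonZeroDivisors

namespace Summit.HodgeConjecture.Ring2WeilCoverage.WeilGramLevel36SurdEleven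

open Literature.AlgebraicGeometry.VanGeemen1994 (weilField weilNormResidueGroup)
open Literature.AlgebraicGeometry.Motives (CMType normUnitsSubgroup)
open Literature.NumberTheory.ComplexMultiplication
open Summit.HodgeConjecture.Ring2WeilCoverage.TraceGramDeterminant (trace_aeval_zeta_mul_inv)
open Summit.HodgeConjecture.Ring2WeilCoverage.WeilGramCMPoint
open Summit.HodgeConjecture.Ring2WeilCoverage.RealUnitNormHalfSystems (complexConj_eq_inv)
open Summit.HodgeConjecture.Ring2WeilCoverage.CyclotomicPrincipalObstruction (complexConj_xi)
open Summit.HodgeConjecture.Ring2WeilCoverage.CyclotomicDifferent (isOfType_one_xi_top xi_ne_zero)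
open Summit.HodgeConjecture.HodgeConjecture.Ring2.WeilCoverage (mk_neg_eq_split_of_odd mk_neg_ne_split_of_odd
  mem_normUnitsSubgroup_of_sq_add_mul_sq)
open Summit.HodgeConjecture.HodgeConjecture.Ring2.Hypotheses (splitDiscriminantClass)
open Summit.HodgeConjecture.Ring2WeilCoverage.WeilGramLevel36
open Summit.HodgeConjecture.Ring2WeilCoverage.WeilGramLevel36Principal
open Summit.HodgeConjecture.Ring2WeilCoverage.WeilGramLevel36SqrtNegThree
open Summit.HodgeConjecture.Ring2WeilCoverage.CyclotomicUnconditional (norm_realUnits_pos_thirtySix)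
open Summit.HodgeConjecture.Ring2WeilCoverage.RealGeneratorTypes (isOfType_one_mul_xi complexConj_mul_xi)
open Summit.HodgeConjecture.Ring2WeilCoverage.SurdTypesLevel36
open Summit.HodgeConjecture.HodgeConjecture.Ring2.WeilCoverage (sixfold_sqrtNeg3_neg11_ne_split)
variable {K : Type} [Field K] [NumberField K] {ζ : K}

/-- `𝐞(t) = exp(2πi t/n) ∈ ℂ` (`ZMod.toCircle`). -/
local notation3 (prettyPrint := false) "𝐞 " t:max => ((ZMod.toCircle t : Circle) : ℂ)

/-- the residue set `S_Φ` read at level `36`. -/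
local notation3 (prettyPrint := false) "SΦ[" Φ "," z "]" =>
  (Finset.univ.filter fun t : ZMod 36 => ∃ σ ∈ (Φ : CMType K).1, σ (z : K) = 𝐞 t)

/-! ### §1 Type `(1 + 2√3)`: `ζ′ = ϖ₁₁ξ` — eleven traces, `det a = −2299968` -/

/-- `Tr(ζ′sθ^0) = 2` for `ζ′ = ϖ₁₁ξ, ϖ₁₁ = 1 + 2θ₃, θ₃ = ζ³ + ζ³³ = √3`, `s = √−3 = 1 + 2ζ¹²`, `θ = ζ + ζ⁻¹` (Euler evaluation). research route conditional on HC_CM; not a corollary; Q11.4-sentence-2 already refuted in dim ≥ 3. [folklore] -/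
theorem trace_varpiEleven_sqrtNegThree_zero [IsCyclotomicExtension {36} ℚ K] (hζ : IsPrimitiveRoot ζ 36) :
    Algebra.trace ℚ K (((1 + 2 * (ζ ^ 3 + ζ ^ 33)) * (ζ ^ 5 * (aeval ζ (derivative (cyclotomic 36 ℚ)))⁻¹)) * (1 + 2 * ζ ^ 12)) = 2 := by
  have h36 : ζ ^ 36 = 1 := hζ.pow_eq_one
  have hΦ := cyc_thirtySix hζ
  rw [trace_of_key₀ hζ (C (0 : ℚ) + C (0 : ℚ) * X + C (-6 : ℚ) * X ^ 2 + C (0 : ℚ) * X ^ 3 + C (0 : ℚ) * X ^ 4 +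
      C (-1 : ℚ) * X ^ 5 + C (0 : ℚ) * X ^ 6 + C (0 : ℚ) * X ^ 7 + C (6 : ℚ) * X ^ 8 + C (0 : ℚ) * X ^ 9 +
      C (0 : ℚ) * X ^ 10 + C (2 : ℚ) * X ^ 11) (by compute_degree) (by
    simp only [map_add, map_mul, map_pow, aeval_C, aeval_X, eq_ratCast]
    push_cast
    linear_combination ((aeval ζ (derivative (cyclotomic 36 ℚ)))⁻¹ * (8 * ζ^2 + 2 * ζ^5 + 4 * ζ^8)) * hΦ +
      ((aeval ζ (derivative (cyclotomic 36 ℚ)))⁻¹ * (2 * ζ^2 + 4 * ζ^14)) * h36)]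
  norm_num [coeff_X_pow, coeff_X, coeff_C, coeff_one]

/-- `Tr(ζ′sθ^1) = 0` for `ζ′ = ϖ₁₁ξ, ϖ₁₁ = 1 + 2θ₃, θ₃ = ζ³ + ζ³³ = √3`, `s = √−3 = 1 + 2ζ¹²`, `θ = ζ + ζ⁻¹` (Euler evaluation). research route conditional on HC_CM; not a corollary; Q11.4-sentence-2 already refuted in dim ≥ 3. [folklore] -/
theorem trace_varpiEleven_sqrtNegThree_one [IsCyclotomicExtension {36} ℚ K] (hζ : IsPrimitiveRoot ζ 36) :
    Algebra.trace ℚ K (((1 + 2 * (ζ ^ 3 + ζ ^ 33)) * (ζ ^ 5 * (aeval ζ (derivative (cyclotomic 36 ℚ)))⁻¹)) * (1 + 2 * ζ ^ 12) * (ζ + ζ⁻¹)) = 0 := by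
  have h36 : ζ ^ 36 = 1 := hζ.pow_eq_one
  have hΦ := cyc_thirtySix hζ
  rw [trace_of_key₁ hζ (C (-2 : ℚ) + C (-6 : ℚ) * X + C (0 : ℚ) * X ^ 2 + C (-6 : ℚ) * X ^ 3 + C (-1 : ℚ) * X ^ 4 +
      C (0 : ℚ) * X ^ 5 + C (1 : ℚ) * X ^ 6 + C (6 : ℚ) * X ^ 7 + C (0 : ℚ) * X ^ 8 + C (6 : ℚ) * X ^ 9 +
      C (2 : ℚ) * X ^ 10 + C (0 : ℚ) * X ^ 11) (by compute_degree) (by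
    simp only [map_add, map_mul, map_pow, aeval_C, aeval_X, eq_ratCast]
    push_cast
    linear_combination ((aeval ζ (derivative (cyclotomic 36 ℚ)))⁻¹ * (2 * ζ + 8 * ζ^2 + 8 * ζ^4 + 2 * ζ^5 + 2 * ζ^7 + 4 * ζ^8 + 4 * ζ^10)) * hΦ +
      ((aeval ζ (derivative (cyclotomic 36 ℚ)))⁻¹ * (2 * ζ^2 + 2 * ζ^4 + 4 * ζ^14 + 4 * ζ^16)) * h36)]
  norm_num [coeff_X_pow, coeff_X, coeff_C, coeff_one]

/-- `Tr(ζ′sθ^2) = 4` for `ζ′ = ϖ₁₁ξ, ϖ₁₁ = 1 + 2θ₃, θ₃ = ζ³ + ζ³³ = √3`, `s = √−3 = 1 + 2ζ¹²`, `θ = ζ + ζ⁻¹` (Euler evaluation). research route conditional on HC_CM; not a corollary; Q11.4-sentence-2 already refuted in dim ≥ 3. [folklore] -/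
theorem trace_varpiEleven_sqrtNegThree_two [IsCyclotomicExtension {36} ℚ K] (hζ : IsPrimitiveRoot ζ 36) :
    Algebra.trace ℚ K (((1 + 2 * (ζ ^ 3 + ζ ^ 33)) * (ζ ^ 5 * (aeval ζ (derivative (cyclotomic 36 ℚ)))⁻¹)) * (1 + 2 * ζ ^ 12) * (ζ + ζ⁻¹) ^ 2) = 4 := by
  have h36 : ζ ^ 36 = 1 := hζ.pow_eq_one
  have hΦ := cyc_thirtySix hζ
  rw [trace_of_key hζ (C (-6 : ℚ) + C (-2 : ℚ) * X + C (-12 : ℚ) * X ^ 2 + C (-1 : ℚ) * X ^ 3 + C (-6 : ℚ) * X ^ 4 +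
      C (-2 : ℚ) * X ^ 5 + C (6 : ℚ) * X ^ 6 + C (1 : ℚ) * X ^ 7 + C (12 : ℚ) * X ^ 8 + C (2 : ℚ) * X ^ 9 +
      C (6 : ℚ) * X ^ 10 + C (4 : ℚ) * X ^ 11) (by compute_degree) (by
    simp only [map_add, map_mul, map_pow, aeval_C, aeval_X, eq_ratCast]
    push_cast
    linear_combination ((aeval ζ (derivative (cyclotomic 36 ℚ)))⁻¹ * (8 * ζ^2 + 2 * ζ^3 + 16 * ζ^4 + 2 * ζ^5 + 8 * ζ^6 + 4 * ζ^7 + 4 * ζ^8 +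
        2 * ζ^9 + 8 * ζ^10 + 4 * ζ^12)) * hΦ +
      ((aeval ζ (derivative (cyclotomic 36 ℚ)))⁻¹ * (2 * ζ^2 + 4 * ζ^4 + 2 * ζ^6 + 4 * ζ^14 + 8 * ζ^16 + 4 * ζ^18)) * h36)]
  norm_num [coeff_X_pow, coeff_X, coeff_C, coeff_one]

/-- `Tr(ζ′sθ^3) = 12` for `ζ′ = ϖ₁₁ξ, ϖ₁₁ = 1 + 2θ₃, θ₃ = ζ³ + ζ³³ = √3`, `s = √−3 = 1 + 2ζ¹²`, `θ = ζ + ζ⁻¹` (Euler evaluation). research route conditional on HC_CM; not a corollary; Q11.4-sentence-2 already refuted in dim ≥ 3. [folklore] -/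
theorem trace_varpiEleven_sqrtNegThree_three [IsCyclotomicExtension {36} ℚ K] (hζ : IsPrimitiveRoot ζ 36) :
    Algebra.trace ℚ K (((1 + 2 * (ζ ^ 3 + ζ ^ 33)) * (ζ ^ 5 * (aeval ζ (derivative (cyclotomic 36 ℚ)))⁻¹)) * (1 + 2 * ζ ^ 12) * (ζ + ζ⁻¹) ^ 3) = 12 := by
  have h36 : ζ ^ 36 = 1 := hζ.pow_eq_one
  have hΦ := cyc_thirtySix hζ
  rw [trace_of_key hζ (C (-6 : ℚ) + C (-18 : ℚ) * X + C (-3 : ℚ) * X ^ 2 + C (-18 : ℚ) * X ^ 3 + C (-3 : ℚ) * X ^ 4 +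
      C (-6 : ℚ) * X ^ 5 + C (3 : ℚ) * X ^ 6 + C (18 : ℚ) * X ^ 7 + C (3 : ℚ) * X ^ 8 + C (18 : ℚ) * X ^ 9 +
      C (6 : ℚ) * X ^ 10 + C (12 : ℚ) * X ^ 11) (by compute_degree) (by
    simp only [map_add, map_mul, map_pow, aeval_C, aeval_X, eq_ratCast]
    push_cast
    linear_combination ((aeval ζ (derivative (cyclotomic 36 ℚ)))⁻¹ * (2 * ζ^2 + 6 * ζ^3 + 24 * ζ^4 + 4 * ζ^5 + 24 * ζ^6 + 6 * ζ^7 + 12 * ζ^8 +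
        6 * ζ^9 + 12 * ζ^10 + 2 * ζ^11 + 12 * ζ^12 + 4 * ζ^14)) * hΦ +
      ((aeval ζ (derivative (cyclotomic 36 ℚ)))⁻¹ * (2 * ζ^2 + 6 * ζ^4 + 6 * ζ^6 + 2 * ζ^8 + 4 * ζ^14 + 12 * ζ^16 + 12 * ζ^18 +
        4 * ζ^20)) * h36)]
  norm_num [coeff_X_pow, coeff_X, coeff_C, coeff_one]

/-- `Tr(ζ′sθ^4) = 12` for `ζ′ = ϖ₁₁ξ, ϖ₁₁ = 1 + 2θ₃, θ₃ = ζ³ + ζ³³ = √3`, `s = √−3 = 1 + 2ζ¹²`, `θ = ζ + ζ⁻¹` (Euler evaluation). research route conditional on HC_CM; not a corollary; Q11.4-sentence-2 already refuted in dim ≥ 3. [folklore] -/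
theorem trace_varpiEleven_sqrtNegThree_four [IsCyclotomicExtension {36} ℚ K] (hζ : IsPrimitiveRoot ζ 36) :
    Algebra.trace ℚ K (((1 + 2 * (ζ ^ 3 + ζ ^ 33)) * (ζ ^ 5 * (aeval ζ (derivative (cyclotomic 36 ℚ)))⁻¹)) * (1 + 2 * ζ ^ 12) * (ζ + ζ⁻¹) ^ 4) = 12 := by
  have h36 : ζ ^ 36 = 1 := hζ.pow_eq_one
  have hΦ := cyc_thirtySix hζ
  rw [trace_of_key hζ (C (-30 : ℚ) + C (-9 : ℚ) * X + C (-36 : ℚ) * X ^ 2 + C (-6 : ℚ) * X ^ 3 + C (-24 : ℚ) * X ^ 4 +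
      C (-6 : ℚ) * X ^ 5 + C (24 : ℚ) * X ^ 6 + C (6 : ℚ) * X ^ 7 + C (36 : ℚ) * X ^ 8 + C (9 : ℚ) * X ^ 9 +
      C (30 : ℚ) * X ^ 10 + C (12 : ℚ) * X ^ 11) (by compute_degree) (by
    simp only [map_add, map_mul, map_pow, aeval_C, aeval_X, eq_ratCast]
    push_cast
    linear_combination ((aeval ζ (derivative (cyclotomic 36 ℚ)))⁻¹ * (2 * ζ^2 + 38 * ζ^4 + 10 * ζ^5 + 48 * ζ^6 + 10 * ζ^7 + 36 * ζ^8 +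
        12 * ζ^9 + 24 * ζ^10 + 8 * ζ^11 + 24 * ζ^12 + 2 * ζ^13 + 16 * ζ^14 +
        4 * ζ^16)) * hΦ +
      ((aeval ζ (derivative (cyclotomic 36 ℚ)))⁻¹ * (2 * ζ^2 + 8 * ζ^4 + 12 * ζ^6 + 8 * ζ^8 + 2 * ζ^10 + 4 * ζ^14 + 16 * ζ^16 +
        24 * ζ^18 + 16 * ζ^20 + 4 * ζ^22)) * h36)]
  norm_num [coeff_X_pow, coeff_X, coeff_C, coeff_one]

/-- `Tr(ζ′sθ^5) = 60` for `ζ′ = ϖ₁₁ξ, ϖ₁₁ = 1 + 2θ₃, θ₃ = ζ³ + ζ³³ = √3`, `s = √−3 = 1 + 2ζ¹²`, `θ = ζ + ζ⁻¹` (Euler evaluation). research route conditional on HC_CM; not a corollary; Q11.4-sentence-2 already refuted in dim ≥ 3. [folklore] -/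
theorem trace_varpiEleven_sqrtNegThree_five [IsCyclotomicExtension {36} ℚ K] (hζ : IsPrimitiveRoot ζ 36) :
    Algebra.trace ℚ K (((1 + 2 * (ζ ^ 3 + ζ ^ 33)) * (ζ ^ 5 * (aeval ζ (derivative (cyclotomic 36 ℚ)))⁻¹)) * (1 + 2 * ζ ^ 12) * (ζ + ζ⁻¹) ^ 5) = 60 := by
  have h36 : ζ ^ 36 = 1 := hζ.pow_eq_one
  have hΦ := cyc_thirtySix hζ
  rw [trace_of_key hζ (C (-21 : ℚ) + C (-66 : ℚ) * X + C (-15 : ℚ) * X ^ 2 + C (-60 : ℚ) * X ^ 3 + C (-12 : ℚ) * X ^ 4 +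
      C (-30 : ℚ) * X ^ 5 + C (12 : ℚ) * X ^ 6 + C (60 : ℚ) * X ^ 7 + C (15 : ℚ) * X ^ 8 + C (66 : ℚ) * X ^ 9 +
      C (21 : ℚ) * X ^ 10 + C (60 : ℚ) * X ^ 11) (by compute_degree) (by
    simp only [map_add, map_mul, map_pow, aeval_C, aeval_X, eq_ratCast]
    push_cast
    linear_combination ((aeval ζ (derivative (cyclotomic 36 ℚ)))⁻¹ * (2 * ζ^2 + 10 * ζ^4 + 22 * ζ^5 + 86 * ζ^6 + 20 * ζ^7 + 84 * ζ^8 +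
        22 * ζ^9 + 60 * ζ^10 + 20 * ζ^11 + 48 * ζ^12 + 10 * ζ^13 + 40 * ζ^14 +
        2 * ζ^15 + 20 * ζ^16 + 4 * ζ^18)) * hΦ +
      ((aeval ζ (derivative (cyclotomic 36 ℚ)))⁻¹ * (2 * ζ^2 + 10 * ζ^4 + 20 * ζ^6 + 20 * ζ^8 + 10 * ζ^10 + 2 * ζ^12 +
        4 * ζ^14 + 20 * ζ^16 + 40 * ζ^18 + 40 * ζ^20 + 20 * ζ^22 + 4 * ζ^24)) * h36)]
  norm_num [coeff_X_pow, coeff_X, coeff_C, coeff_one]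

/-- `Tr(ζ′sθ^6) = 42` for `ζ′ = ϖ₁₁ξ, ϖ₁₁ = 1 + 2θ₃, θ₃ = ζ³ + ζ³³ = √3`, `s = √−3 = 1 + 2ζ¹²`, `θ = ζ + ζ⁻¹` (Euler evaluation). research route conditional on HC_CM; not a corollary; Q11.4-sentence-2 already refuted in dim ≥ 3. [folklore] -/
theorem trace_varpiEleven_sqrtNegThree_six [IsCyclotomicExtension {36} ℚ K] (hζ : IsPrimitiveRoot ζ 36) :
    Algebra.trace ℚ K (((1 + 2 * (ζ ^ 3 + ζ ^ 33)) * (ζ ^ 5 * (aeval ζ (derivative (cyclotomic 36 ℚ)))⁻¹)) * (1 + 2 * ζ ^ 12) * (ζ + ζ⁻¹) ^ 6) = 42 := by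
  have h36 : ζ ^ 36 = 1 := hζ.pow_eq_one
  have hΦ := cyc_thirtySix hζ
  rw [trace_of_key hζ (C (-126 : ℚ) + C (-36 : ℚ) * X + C (-126 : ℚ) * X ^ 2 + C (-27 : ℚ) * X ^ 3 + C (-90 : ℚ) * X ^ 4 +
      C (-21 : ℚ) * X ^ 5 + C (90 : ℚ) * X ^ 6 + C (27 : ℚ) * X ^ 7 + C (126 : ℚ) * X ^ 8 + C (36 : ℚ) * X ^ 9 +
      C (126 : ℚ) * X ^ 10 + C (42 : ℚ) * X ^ 11) (by compute_degree) (by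
    simp only [map_add, map_mul, map_pow, aeval_C, aeval_X, eq_ratCast]
    push_cast
    linear_combination ((aeval ζ (derivative (cyclotomic 36 ℚ)))⁻¹ * (2 * ζ^2 + 12 * ζ^4 + ζ^5 + 156 * ζ^6 + 42 * ζ^7 + 170 * ζ^8 + 42 * ζ^9 +
        144 * ζ^10 + 42 * ζ^11 + 108 * ζ^12 + 30 * ζ^13 + 88 * ζ^14 + 12 * ζ^15 +
        60 * ζ^16 + 2 * ζ^17 + 24 * ζ^18 + 4 * ζ^20)) * hΦ +
      ((aeval ζ (derivative (cyclotomic 36 ℚ)))⁻¹ * (2 * ζ^2 + 12 * ζ^4 + 30 * ζ^6 + 40 * ζ^8 + 30 * ζ^10 + 12 * ζ^12 +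
        6 * ζ^14 + 24 * ζ^16 + 60 * ζ^18 + 80 * ζ^20 + 60 * ζ^22 + 24 * ζ^24 +
        4 * ζ^26)) * h36)]
  norm_num [coeff_X_pow, coeff_X, coeff_C, coeff_one]

/-- `Tr(ζ′sθ^7) = 252` for `ζ′ = ϖ₁₁ξ, ϖ₁₁ = 1 + 2θ₃, θ₃ = ζ³ + ζ³³ = √3`, `s = √−3 = 1 + 2ζ¹²`, `θ = ζ + ζ⁻¹` (Euler evaluation). research route conditional on HC_CM; not a corollary; Q11.4-sentence-2 already refuted in dim ≥ 3. [folklore] -/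
theorem trace_varpiEleven_sqrtNegThree_seven [IsCyclotomicExtension {36} ℚ K] (hζ : IsPrimitiveRoot ζ 36) :
    Algebra.trace ℚ K (((1 + 2 * (ζ ^ 3 + ζ ^ 33)) * (ζ ^ 5 * (aeval ζ (derivative (cyclotomic 36 ℚ)))⁻¹)) * (1 + 2 * ζ ^ 12) * (ζ + ζ⁻¹) ^ 7) = 252 := by
  have h36 : ζ ^ 36 = 1 := hζ.pow_eq_one
  have hΦ := cyc_thirtySix hζ
  rw [trace_of_key hζ (C (-78 : ℚ) + C (-252 : ℚ) * X + C (-63 : ℚ) * X ^ 2 + C (-216 : ℚ) * X ^ 3 + C (-48 : ℚ) * X ^ 4 +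
      C (-126 : ℚ) * X ^ 5 + C (48 : ℚ) * X ^ 6 + C (216 : ℚ) * X ^ 7 + C (63 : ℚ) * X ^ 8 + C (252 : ℚ) * X ^ 9 +
      C (78 : ℚ) * X ^ 10 + C (252 : ℚ) * X ^ 11) (by compute_degree) (by
    simp only [map_add, map_mul, map_pow, aeval_C, aeval_X, eq_ratCast]
    push_cast
    linear_combination ((aeval ζ (derivative (cyclotomic 36 ℚ)))⁻¹ * (2 * ζ^2 + 14 * ζ^4 + ζ^5 + 42 * ζ^6 + 85 * ζ^7 + 326 * ζ^8 + 84 * ζ^9 +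
        314 * ζ^10 + 84 * ζ^11 + 252 * ζ^12 + 72 * ζ^13 + 196 * ζ^14 + 42 * ζ^15 +
        148 * ζ^16 + 14 * ζ^17 + 84 * ζ^18 + 2 * ζ^19 + 28 * ζ^20 + 4 * ζ^22)) * hΦ +
      ((aeval ζ (derivative (cyclotomic 36 ℚ)))⁻¹ * (2 * ζ^2 + 14 * ζ^4 + 42 * ζ^6 + 70 * ζ^8 + 70 * ζ^10 + 42 * ζ^12 +
        18 * ζ^14 + 30 * ζ^16 + 84 * ζ^18 + 140 * ζ^20 + 140 * ζ^22 + 84 * ζ^24 +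
        28 * ζ^26 + 4 * ζ^28)) * h36)]
  norm_num [coeff_X_pow, coeff_X, coeff_C, coeff_one]

/-- `Tr(ζ′sθ^8) = 156` for `ζ′ = ϖ₁₁ξ, ϖ₁₁ = 1 + 2θ₃, θ₃ = ζ³ + ζ³³ = √3`, `s = √−3 = 1 + 2ζ¹²`, `θ = ζ + ζ⁻¹` (Euler evaluation). research route conditional on HC_CM; not a corollary; Q11.4-sentence-2 already refuted in dim ≥ 3. [folklore] -/
theorem trace_varpiEleven_sqrtNegThree_eight [IsCyclotomicExtension {36} ℚ K] (hζ : IsPrimitiveRoot ζ 36) :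
    Algebra.trace ℚ K (((1 + 2 * (ζ ^ 3 + ζ ^ 33)) * (ζ ^ 5 * (aeval ζ (derivative (cyclotomic 36 ℚ)))⁻¹)) * (1 + 2 * ζ ^ 12) * (ζ + ζ⁻¹) ^ 8) = 156 := by
  have h36 : ζ ^ 36 = 1 := hζ.pow_eq_one
  have hΦ := cyc_thirtySix hζ
  rw [trace_of_key hζ (C (-504 : ℚ) + C (-141 : ℚ) * X + C (-468 : ℚ) * X ^ 2 + C (-111 : ℚ) * X ^ 3 + C (-342 : ℚ) * X ^ 4 +
      C (-78 : ℚ) * X ^ 5 + C (342 : ℚ) * X ^ 6 + C (111 : ℚ) * X ^ 7 + C (468 : ℚ) * X ^ 8 +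
      C (141 : ℚ) * X ^ 9 + C (504 : ℚ) * X ^ 10 + C (156 : ℚ) * X ^ 11) (by compute_degree) (by
    simp only [map_add, map_mul, map_pow, aeval_C, aeval_X, eq_ratCast]
    push_cast
    linear_combination ((aeval ζ (derivative (cyclotomic 36 ℚ)))⁻¹ * (4 + 2 * ζ^2 + 16 * ζ^4 + ζ^5 + 60 * ζ^6 + 8 * ζ^7 + 620 * ζ^8 +
        169 * ζ^9 + 640 * ζ^10 + 168 * ζ^11 + 566 * ζ^12 + 156 * ζ^13 +
        448 * ζ^14 + 114 * ζ^15 + 344 * ζ^16 + 56 * ζ^17 + 228 * ζ^18 +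
        16 * ζ^19 + 112 * ζ^20 + 2 * ζ^21 + 32 * ζ^22)) * hΦ +
      ((aeval ζ (derivative (cyclotomic 36 ℚ)))⁻¹ * (4 + 2 * ζ^2 + 16 * ζ^4 + 56 * ζ^6 + 112 * ζ^8 + 140 * ζ^10 + 112 * ζ^12 +
        60 * ζ^14 + 48 * ζ^16 + 114 * ζ^18 + 224 * ζ^20 + 280 * ζ^22 +
        224 * ζ^24 + 112 * ζ^26 + 32 * ζ^28 + 4 * ζ^30)) * h36)]
  norm_num [coeff_X_pow, coeff_X, coeff_C, coeff_one]

/-- `Tr(ζ′sθ^9) = 1008` for `ζ′ = ϖ₁₁ξ, ϖ₁₁ = 1 + 2θ₃, θ₃ = ζ³ + ζ³³ = √3`, `s = √−3 = 1 + 2ζ¹²`, `θ = ζ + ζ⁻¹` (Euler evaluation). research route conditional on HC_CM; not a corollary; Q11.4-sentence-2 already refuted in dim ≥ 3. [folklore] -/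
theorem trace_varpiEleven_sqrtNegThree_nine [IsCyclotomicExtension {36} ℚ K] (hζ : IsPrimitiveRoot ζ 36) :
    Algebra.trace ℚ K (((1 + 2 * (ζ ^ 3 + ζ ^ 33)) * (ζ ^ 5 * (aeval ζ (derivative (cyclotomic 36 ℚ)))⁻¹)) * (1 + 2 * ζ ^ 12) * (ζ + ζ⁻¹) ^ 9) = 1008 := by
  have h36 : ζ ^ 36 = 1 := hζ.pow_eq_one
  have hΦ := cyc_thirtySix hζ
  rw [trace_of_key hζ (C (-297 : ℚ) + C (-972 : ℚ) * X + C (-252 : ℚ) * X ^ 2 + C (-810 : ℚ) * X ^ 3 + C (-189 : ℚ) * X ^ 4 +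
      C (-504 : ℚ) * X ^ 5 + C (189 : ℚ) * X ^ 6 + C (810 : ℚ) * X ^ 7 + C (252 : ℚ) * X ^ 8 +
      C (972 : ℚ) * X ^ 9 + C (297 : ℚ) * X ^ 10 + C (1008 : ℚ) * X ^ 11) (by compute_degree) (by
    simp only [map_add, map_mul, map_pow, aeval_C, aeval_X, eq_ratCast]
    push_cast
    linear_combination ((aeval ζ (derivative (cyclotomic 36 ℚ)))⁻¹ * (36 + 6 * ζ^2 + 18 * ζ^4 + ζ^5 + 108 * ζ^6 + 9 * ζ^7 + 176 * ζ^8 +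
        333 * ζ^9 + 1260 * ζ^10 + 337 * ζ^11 + 1206 * ζ^12 + 324 * ζ^13 +
        1014 * ζ^14 + 270 * ζ^15 + 792 * ζ^16 + 170 * ζ^17 + 540 * ζ^18 +
        72 * ζ^19 + 340 * ζ^20 + 18 * ζ^21 + 144 * ζ^22 + 2 * ζ^23)) * hΦ +
      ((aeval ζ (derivative (cyclotomic 36 ℚ)))⁻¹ * (36 + 6 * ζ^2 + 18 * ζ^4 + 72 * ζ^6 + 168 * ζ^8 + 252 * ζ^10 + 252 * ζ^12 +
        172 * ζ^14 + 108 * ζ^16 + 162 * ζ^18 + 338 * ζ^20 + 504 * ζ^22 +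
        504 * ζ^24 + 336 * ζ^26 + 144 * ζ^28 + 36 * ζ^30 + 4 * ζ^32)) * h36)]
  norm_num [coeff_X_pow, coeff_X, coeff_C, coeff_one]

/-- `Tr(ζ′sθ^10) = 594` for `ζ′ = ϖ₁₁ξ, ϖ₁₁ = 1 + 2θ₃, θ₃ = ζ³ + ζ³³ = √3`, `s = √−3 = 1 + 2ζ¹²`, `θ = ζ + ζ⁻¹` (Euler evaluation). research route conditional on HC_CM; not a corollary; Q11.4-sentence-2 already refuted in dim ≥ 3. [folklore] -/
theorem trace_varpiEleven_sqrtNegThree_ten [IsCyclotomicExtension {36} ℚ K] (hζ : IsPrimitiveRoot ζ 36) :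
    Algebra.trace ℚ K (((1 + 2 * (ζ ^ 3 + ζ ^ 33)) * (ζ ^ 5 * (aeval ζ (derivative (cyclotomic 36 ℚ)))⁻¹)) * (1 + 2 * ζ ^ 12) * (ζ + ζ⁻¹) ^ 10) = 594 := by
  have h36 : ζ ^ 36 = 1 := hζ.pow_eq_one
  have hΦ := cyc_thirtySix hζ
  rw [trace_of_key hζ (C (-1980 : ℚ) + C (-549 : ℚ) * X + C (-1782 : ℚ) * X ^ 2 + C (-441 : ℚ) * X ^ 3 + C (-1314 : ℚ) * X ^ 4 +
      C (-297 : ℚ) * X ^ 5 + C (1314 : ℚ) * X ^ 6 + C (441 : ℚ) * X ^ 7 + C (1782 : ℚ) * X ^ 8 +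
      C (549 : ℚ) * X ^ 9 + C (1980 : ℚ) * X ^ 10 + C (594 : ℚ) * X ^ 11) (by compute_degree) (by
    simp only [map_add, map_mul, map_pow, aeval_C, aeval_X, eq_ratCast]
    push_cast
    linear_combination ((aeval ζ (derivative (cyclotomic 36 ℚ)))⁻¹ * (180 + 2 * ζ + 42 * ζ^2 + 24 * ζ^4 + ζ^5 + 270 * ζ^6 + 12 * ζ^7 +
        284 * ζ^8 + 45 * ζ^9 + 2444 * ζ^10 + 670 * ζ^11 + 2466 * ζ^12 +
        661 * ζ^13 + 2220 * ζ^14 + 594 * ζ^15 + 1806 * ζ^16 + 440 * ζ^17 +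
        1188 * ζ^18 + 240 * ζ^19 + 880 * ζ^20 + 90 * ζ^21 + 484 * ζ^22 +
        20 * ζ^23)) * hΦ +
      ((aeval ζ (derivative (cyclotomic 36 ℚ)))⁻¹ * (180 + 2 * ζ + 42 * ζ^2 + 24 * ζ^4 + 90 * ζ^6 + 240 * ζ^8 + 420 * ζ^10 +
        504 * ζ^12 + 424 * ζ^14 + 280 * ζ^16 + 270 * ζ^18 + 500 * ζ^20 +
        842 * ζ^22 + 1008 * ζ^24 + 840 * ζ^26 + 480 * ζ^28 + 180 * ζ^30 +
        40 * ζ^32 + 4 * ζ^34)) * h36)]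
  norm_num [coeff_X_pow, coeff_X, coeff_C, coeff_one]

/-- **The Gram datum `a` of `(E_ζ′, s)` in the real frame `θ^i` (`i < 6`)** for `ζ′ = ϖ₁₁ξ, ϖ₁₁ = 1 + 2θ₃, θ₃ = ζ³ + ζ³³ = √3` (type (ϖ₁₁): `𝔬𝔣₀(1 − 2θ₃) = (11)`, degree 1331),
`s = √−3 = 1 + 2ζ¹²`: the integer Hankel matrix `(−Tr(ζ′sθ^{i+j}))ᵢⱼ` (and `b = 0`, part 82 `hb_eq_zero`).
research route conditional on HC_CM; not a corollary; Q11.4-sentence-2 already refuted in dim ≥ 3. [cite: vanGeemen1994HodgeAV, Lemma 5.2 (2)–(3)] -/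
theorem realPart_varpiEleven_sqrtNegThree [IsCyclotomicExtension {36} ℚ K] [IsCMField K] (hζ : IsPrimitiveRoot ζ 36)
    {x : Fin 6 → K} (hx : ∀ i, x i = (ζ + ζ⁻¹) ^ (i : ℕ)) {a : Matrix (Fin 6) (Fin 6) ℚ}
    (ha : ∀ i j, a i j = Algebra.trace ℚ K (((1 + 2 * (ζ ^ 3 + ζ ^ 33)) * (ζ ^ 5 * (aeval ζ (derivative (cyclotomic 36 ℚ)))⁻¹)) * x i * IsCMField.complexConj K ((1 + 2 * ζ ^ 12) * x j))) :
    a = !![-2, 0, -4, -12, -12, -60; 0, -4, -12, -12, -60, -42; -4, -12, -12, -60, -42, -252; -12, -12, -60, -42, -252, -156; -12, -60, -42, -252, -156, -1008; -60, -42, -252, -156, -1008, -594] := by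
  rw [ha_eq (complexConj_sqrtNegThree hζ) (complexConj_thetaFrame hζ hx) ha]
  ext i j
  simp only [Matrix.of_apply, hx, ← pow_add]
  fin_cases i <;> fin_cases j <;> simp [trace_varpiEleven_sqrtNegThree_zero hζ, trace_varpiEleven_sqrtNegThree_one hζ, trace_varpiEleven_sqrtNegThree_two hζ, trace_varpiEleven_sqrtNegThree_three hζ, trace_varpiEleven_sqrtNegThree_four hζ, trace_varpiEleven_sqrtNegThree_five hζ,
    trace_varpiEleven_sqrtNegThree_six hζ, trace_varpiEleven_sqrtNegThree_seven hζ, trace_varpiEleven_sqrtNegThree_eight hζ, trace_varpiEleven_sqrtNegThree_nine hζ, trace_varpiEleven_sqrtNegThree_ten hζ]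

/-- **`det a = -2299968`** for `ζ′ = ϖ₁₁ξ, ϖ₁₁ = 1 + 2θ₃, θ₃ = ζ³ + ζ³³ = √3`, `s = √−3 = 1 + 2ζ¹²` (frame `θ^i`, `i < 6`). research route conditional on HC_CM; not a corollary; Q11.4-sentence-2 already refuted in dim ≥ 3. [cite: vanGeemen1994HodgeAV, Lemma 5.2 (3)] -/
theorem det_realPart_varpiEleven_sqrtNegThree [IsCyclotomicExtension {36} ℚ K] [IsCMField K] (hζ : IsPrimitiveRoot ζ 36)
    {x : Fin 6 → K} (hx : ∀ i, x i = (ζ + ζ⁻¹) ^ (i : ℕ)) {a : Matrix (Fin 6) (Fin 6) ℚ}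
    (ha : ∀ i j, a i j = Algebra.trace ℚ K (((1 + 2 * (ζ ^ 3 + ζ ^ 33)) * (ζ ^ 5 * (aeval ζ (derivative (cyclotomic 36 ℚ)))⁻¹)) * x i * IsCMField.complexConj K ((1 + 2 * ζ ^ 12) * x j))) :
    a.det = -2299968 := by
  rw [realPart_varpiEleven_sqrtNegThree hζ hx ha]
  simp [Matrix.det_succ_row_zero, Fin.sum_univ_succ, Fin.succAbove, Matrix.submatrix]
  norm_num

/-! ### §2 Invariance, census form, class: `[−11]` NON-SPLIT -/

/-- **For EVERY skew `ζ′` of type `(1 + 2√3)` (degree `11³ = 1331`) on `ℤ[ζ_36]` (`IsOfType 1 ζ′ 𝔣₀`, `𝔬𝔣₀ = (ϖ)`, `𝔬𝔣₀·(1 − 2θ₃) = (11)`, degree `1331`; `ζ′ = u·ϖξ`,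
`u` a real unit of norm `1` by THEOREM L (i) at `36`) the Gram determinant of `(E_ζ′, s₃)` in the frame `θ^i` is `-2299968`**
(they exist on every `ℚ(√−3)`-balanced `Φ`, part 54c): the NON-SPLIT row `(3, ℚ(√−3), 11)`, `T = {3, 11}` (pub-hsemireg R2, `a = 11`; census W6.3.11).
research route conditional on HC_CM; not a corollary; Q11.4-sentence-2 already refuted in dim ≥ 3. [cite: vanGeemen1994HodgeAV, Lemma 5.2 (3)–(4) and (5.4.1)] [cite: Shimura1998, §14.3 Prop. 4–5, pp. 103–104] -/
theorem det_realPart_surdEleven_sqrtNegThree [IsCyclotomicExtension {36} ℚ K] [IsCMField K]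
    (hζ : IsPrimitiveRoot ζ 36) {𝔣₀ : Ideal (𝓞 (maximalRealSubfield K))}
    (h𝔣₀ : 𝔣₀.map (algebraMap (𝓞 (maximalRealSubfield K)) (𝓞 K)) =
      Ideal.span {(1 + 2 * (hζ.toInteger ^ 3 + hζ.toInteger ^ 33) : 𝓞 K)})
    {ζ' : K} (hζ' : IsCMField.complexConj K ζ' = -ζ')
    (hT : CMTypeLattice.IsOfType (1 : (FractionalIdeal (𝓞 K)⁰ K)ˣ) ζ' 𝔣₀)
    {x : Fin 6 → K} (hx : ∀ i, x i = (ζ + ζ⁻¹) ^ (i : ℕ)) {a : Matrix (Fin 6) (Fin 6) ℚ}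
    (ha : ∀ i j, a i j = Algebra.trace ℚ K (ζ' * x i * IsCMField.complexConj K ((1 + 2 * ζ ^ 12) * x j))) :
    a.det = -2299968 := by
  obtain ⟨ωb, hωb⟩ := exists_basis_thetaPow hζ
  have hx' : ∀ i, x i = (ωb i : K) := fun i => (hx i).trans (hωb i).symm
  have hg : Nat.totient 36 = 2 * (5 + 1) := by decide
  obtain ⟨-, hreal, hϖ0⟩ := signSet_thirtySix_eleven hζ
  have hP := coe_surd_thirtySix hζ
  have hsk := complexConj_mul_xi hζ hg hreal
  have h0 := mul_ne_zero hϖ0 (xi_ne_zero hζ 5)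
  have hT₀ := isOfType_one_mul_xi hζ 5 hP h𝔣₀
  rw [det_realPart_eq_of_isOfType ωb (complexConj_sqrtNegThree hζ) hx' (norm_realUnits_pos_thirtySix hζ)
    hsk h0 hζ' hT₀ hT (fun i j => rfl) ha]
  exact det_realPart_varpiEleven_sqrtNegThree hζ hx (fun i j => rfl)

open scoped Classical in
/-- **CENSUS FORM** (part 54c's existence + the determinant): for every CM type `Φ` of `ℚ(ζ_36)` balanced for `N_K = {5, 11, 17, 23, 29, 35}` (Weil signature `(3,3)`
for `K_d = ℚ(√−3)`) and the type `𝔣₀` above, `ℂ^Φ/Φ(ℤ[ζ_36])` carries a `Φ`-positive divisor of type `(K; Φ; 𝔣₀)`, and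
EVERY such divisor `X_ζ′` has van Geemen Gram determinant `-2299968` in the real frame `θ^i`: the NON-SPLIT row `(3, ℚ(√−3), 11)`, `T = {3, 11}` (pub-hsemireg R2, `a = 11`; census W6.3.11).
research route conditional on HC_CM; not a corollary; Q11.4-sentence-2 already refuted in dim ≥ 3. [cite: vanGeemen1994HodgeAV, Lemma 5.2 (3)–(4) and (5.4.1)] [cite: Shimura1998, §14.3 Prop. 4–5, pp. 103–104] -/
theorem exists_surdEleven_sqrtNegThree_det [IsCyclotomicExtension {36} ℚ K] [IsCMField K]
    (hζ : IsPrimitiveRoot ζ 36) (Φ : CMType K)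
    (hbal : 2 * (SΦ[Φ, ζ] ∩ ({5, 11, 17, 23, 29, 35} : Finset (ZMod 36))).card = (SΦ[Φ, ζ]).card)
    {𝔣₀ : Ideal (𝓞 (maximalRealSubfield K))}
    (h𝔣₀ : 𝔣₀.map (algebraMap (𝓞 (maximalRealSubfield K)) (𝓞 K)) =
      Ideal.span {(1 + 2 * (hζ.toInteger ^ 3 + hζ.toInteger ^ 33) : 𝓞 K)}) :
    ∃ ζ' : K, IsCMField.complexConj K ζ' = -ζ' ∧ (∀ φ : Φ.1, 0 < (φ.1 ζ').im) ∧
      CMTypeLattice.IsOfType (1 : (FractionalIdeal (𝓞 K)⁰ K)ˣ) ζ' 𝔣₀ ∧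
      ∀ (x : Fin 6 → K), (∀ i, x i = (ζ + ζ⁻¹) ^ (i : ℕ)) → ∀ a : Matrix (Fin 6) (Fin 6) ℚ,
        (∀ i j, a i j = Algebra.trace ℚ K (ζ' * x i * IsCMField.complexConj K ((1 + 2 * ζ ^ 12) * x j))) →
        a.det = -2299968 := by
  obtain ⟨ζ', h1, h2, h3⟩ := exists_type_thirtySix_eleven_sqrt_neg_three hζ Φ hbal h𝔣₀
  exact ⟨ζ', h1, h2, h3, fun x hx a ha => det_realPart_surdEleven_sqrtNegThree hζ h𝔣₀ h1 h3 hx ha⟩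

/-- **`[-2299968] = [−11] ≠ splitDiscriminantClass 3 3` in `ℚˣ/Nm(ℚ(√−3)ˣ)`** (`11/2299968 = (0)² + 3·((1 / 792))² ∈ Nm`; the key `[−11] ≠ split` is ring2-b04's `sixfold_sqrtNeg3_neg11_ne_split`):
the type-`(1 + 2√3)` (degree `1331`) polarised Weil-type `ℤ[ζ₃₆]`-CM sixfolds lie on the NON-SPLIT row `(3, ℚ(√−3), 11)`, `T = {3, 11}` (pub-hsemireg R2, `a = 11`; census W6.3.11).
research route conditional on HC_CM; not a corollary; Q11.4-sentence-2 already refuted in dim ≥ 3. [cite: vanGeemen1994HodgeAV, 5.4 and (5.4.1)] [cite: Serre1973, Ch. III §1] -/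
theorem mk0_det_surdEleven_sqrtNegThree :
    (QuotientGroup.mk (Units.mk0 (-2299968 : ℚ) (by norm_num)) : weilNormResidueGroup 3) =
        QuotientGroup.mk (Units.mk0 (-11 : ℚ) (by norm_num)) ∧
      (QuotientGroup.mk (Units.mk0 (-11 : ℚ) (by norm_num)) : weilNormResidueGroup 3) ≠
        splitDiscriminantClass 3 3 := by
  constructor
  · rw [QuotientGroup.eq]
    have e : (Units.mk0 (-2299968 : ℚ) (by norm_num))⁻¹ * Units.mk0 (-11 : ℚ) (by norm_num) =
        Units.mk0 (((1 / 209088)) : ℚ) (by norm_num) := Units.ext (by norm_num)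
    rw [e]
    exact mem_normUnitsSubgroup_of_sq_add_mul_sq _ (0 : ℚ) ((1 / 792) : ℚ) (by norm_num)
  · exact sixfold_sqrtNeg3_neg11_ne_split

end Summit.HodgeConjecture.Ring2WeilCoverage.WeilGramLevel36SurdEleven

end
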